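import Literature.Computability.AlgebraicComplexity.CapabilityBound
import Literature.Computability.AlgebraicComplexity.HwvEvaluationRankBound

/-!
# The capability bound along a TOWER of paddings (`det_{n'}` shadow of `x₀₀^{m-n} per_n` versus `det_m`)

For `0 < n < n' < m`, characteristic zero and `λ ⊢ m d` with at most `m²` parts:
`mult_{λ*} k[Δ(x₀₀^{m-n} per_n)] ≤ mult_{λ*} k[Δ(det_m)] + ε^{det_{n'}}(λ; d)`,
`ε^{det_{n'}}(λ; d) = Σ_{λ/μ horizontal strip, μ ⊢ n' d, ℓ(μ) ≤ n'²} (a_{μ*} − mult_{μ*} k[Δ(det_{n'})])`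
(`orbitMultiplicity_paddedPerFormLex_le_detFormLex_add_capDeficitSumPieri_tower`), with the certified-lower-bound
and INCAPABLE (all keys full) forms.  This is the cell `pub-gct-max`'s NOTE V26 («det₄ shadow»: a `(x₀₀² per₃, det₅)`
multiplicity obstruction in degree `d` needs a `det₄` orbit-closure equation of horizontal-strip type in the same degree),
`(n, n', m) = (3, 4, 5)`, in general form; THEOREM V23-bis of the cell is `CapabilityBound`'s (C4) itself.
## Proof
(C4) `orbitMultiplicity_pad_le_detFormLex_add_capDeficitSumPieri` at `(n', m)` with the block form
`h' := x'₀₀^{n'-n} per_n = paddedPerFormLex k n n'`, composed with the TOWER CONTAINMENT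
`x₀₀^{m-n} per_n ∈ Δ(x₀₀^{m-n'} · ι(x'₀₀^{n'-n} per_n))` — substitute the block's own padding letter `x'₀₀ ↦ x₀₀`, a linear
substitution by a 0/1 matrix, hence an `End`-orbit point (`linSubst_mem_orbitClosure`, BLMW 2011 §6.3) — and monotonicity of
multiplicities under orbit-closure containment (`orbitMultiplicity_le_of_hwv_inf_le` with
`orbitVanishingIdeal_le_of_mem_orbitClosure`, Bläser–Ikenmeyer §12.4).  No named facts; no new definitions.
Honest framing (cell `pub-gct-max`): an elementary representation-theoretic bound assembled from printed parts — an
INSTRUMENT saying where a multiplicity obstruction cannot live; multiplicity data and certified rank bounds at small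
parameters; occurrence obstructions are ruled out in print (BIP'16) — multiplicity obstructions are the open door; nothing
here is a claim on VP vs VNP or P vs NP.
## References
* [BurgisserEtAl2011] Prop. 6.3.2, §6.3; [FultonHarrisGTM129] (6.8) (Pieri); [MulmuleySohoni2001] §4 (`End · f ⊆ Δ[f]`);
  [BlaeserIkenmeyer2025] §12.4 (monotonicity of multiplicities); [Landsberg2017] Prop. 8.4.1.1.
-/

noncomputable section

open MvPolynomial

namespace Literature.Computability.AlgebraicComplexity

open _root_.Literature.NumberTheory.DiophantineGeometry

/-- `rename` by an arbitrary self-map of the letters is a linear substitution (by a 0/1 matrix), hence lands in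
the orbit closure (`End · f ⊆ Δ[f]`, `linSubst_mem_orbitClosure`). Mulmuley–Sohoni 2001 §4. [cite: MulmuleySohoni2001, §4] -/
theorem rename_mem_orbitClosure_of_selfMap {k : Type*} [Field k] [Infinite k] {σ : Type*} [Fintype σ]
    [LinearOrder σ] (κ : σ → σ) (f : MvPolynomial σ k) :
    rename κ f ∈ orbitClosure f := by
  classical
  set A : Matrix σ σ k := Matrix.of fun j i => if j = κ i then (1 : k) else 0 with hA
  have hX : ∀ i, linSubst σ k A (X i) = X (κ i) := by
    intro i
    rw [linSubst_X]
    have hs : ∀ j, A j i • (X j : MvPolynomial σ k) = if j = κ i then X j else 0 := by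
      intro j
      rw [hA, Matrix.of_apply]
      split_ifs <;> simp
    rw [Finset.sum_congr rfl fun j _ => hs j, Finset.sum_ite_eq' Finset.univ (κ i)]
    simp
  have hAlg : linSubst σ k A = rename κ :=
    MvPolynomial.algHom_ext fun i => by rw [hX i, rename_X]
  have hmem := linSubst_mem_orbitClosure f A
  rw [hAlg] at hmem
  exact hmem

section Tower

variable {k : Type} [Field k]

/-- Block placements compose: placing the `n × n` letters in the `n' × n'` block and that block in the
`m × m` letters is the block placement `n ≤ m` (the tree's `blockEmb i = m - n + i` on both indices).
[cite: BurgisserEtAl2011, §6.3 (after Prop. 6.3.2)] -/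
theorem blockPlace_comp_blockPlace {n n' m : ℕ} (h1 : n ≤ n') (h2 : n' ≤ m) :
    (blockPlace h2) ∘ (blockPlace h1) = blockPlace (h1.trans h2) := by
  funext x
  simp only [Function.comp_apply, blockPlace, ofLex_toLex]
  congr 1
  ext
  · simp only [blockEmb_val]; omega
  · simp only [blockEmb_val]; omega

/-- **Tower containment.** `x₀₀^{m-n} per_n ∈ Δ(x₀₀^{m-n'} · ι(x'₀₀^{n'-n} per_n))` for `n < n' < m`
(substitute the block's own padding letter by `x₀₀`; an `End`-orbit point). [cite: BurgisserEtAl2011, §6.3 (after Prop. 6.3.2)] -/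
theorem paddedPerFormLex_mem_orbitClosure_pad_paddedPerFormLex [Infinite k] {n n' m : ℕ} [NeZero n']
    [NeZero m] (h1 : n < n') (h2 : n' < m) :
    paddedPerFormLex k n m ∈ orbitClosure (X (toLex ((0 : Fin m), (0 : Fin m))) ^ (m - n') *
      rename (blockPlace h2.le) (paddedPerFormLex k n n')) := by
  set t : MatIdx m := toLex ((0 : Fin m), (0 : Fin m)) with ht
  set t' : MatIdx n' := toLex ((0 : Fin n'), (0 : Fin n')) with ht'
  -- the substitution letter: w = placement of the block's padding letter among the m × m letters
  set w : MatIdx m := blockPlace h2.le t' with hw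
  have htw : t ≠ w := by
    intro h
    exact toLex_zero_not_mem_range_blockPlace (n := n') (m := m) h2 ⟨t', by rw [← hw, ← h]⟩
  -- κ : w ↦ t, identity elsewhere
  let κ : MatIdx m → MatIdx m := Function.update id w t
  have hκt : κ t = t := by
    show Function.update id w t t = t
    rw [Function.update_of_ne htw]; rfl
  have hκw : κ w = t := by
    show Function.update id w t w = t
    rw [Function.update_self]
  have hκblock : ∀ x : MatIdx n, κ (blockPlace h2.le (blockPlace h1.le x)) =
      blockPlace (h1.le.trans h2.le) x := by
    intro x
    have hne : blockPlace h2.le (blockPlace h1.le x) ≠ w := by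
      intro h
      have h' := blockPlace_injective h2.le h
      exact toLex_zero_not_mem_range_blockPlace (n := n) (m := n') h1 ⟨x, by rw [h', ht']⟩
    show Function.update id w t (blockPlace h2.le (blockPlace h1.le x)) = _
    rw [Function.update_of_ne hne]
    exact congrFun (blockPlace_comp_blockPlace h1.le h2.le) x
  have hF : (κ ∘ blockPlace h2.le ∘ blockPlace h1.le ∘ (toLex : Fin n × Fin n → MatIdx n)) =
      (blockPlace (h1.le.trans h2.le) ∘ (toLex : Fin n × Fin n → MatIdx n)) := by
    funext x
    simp only [Function.comp_apply]
    exact hκblock (toLex x)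
  have hrename : rename κ (X t ^ (m - n') * rename (blockPlace h2.le) (paddedPerFormLex k n n')) =
      paddedPerFormLex k n m := by
    rw [paddedPerFormLex_eq_pad h1.le, paddedPerFormLex_eq_pad (h1.le.trans h2.le), ← ht', ← ht]
    simp only [map_mul, map_pow, rename_X, rename_rename, hκt]
    rw [show blockPlace h2.le t' = w from rfl, hκw, hF, ← mul_assoc, ← pow_add]
    have he : m - n' + (n' - n) = m - n := by omega
    rw [he]
  rw [← hrename]
  exact rename_mem_orbitClosure_of_selfMap κ _

/-- **Tower monotonicity.** `mult_χ k[Δ(x₀₀^{m-n} per_n)] ≤ mult_χ k[Δ(x₀₀^{m-n'} · ι(x'₀₀^{n'-n} per_n))]`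
(multiplicities do not increase under orbit-closure containment). [cite: BlaeserIkenmeyer2025, §12.4] -/
theorem orbitMultiplicity_paddedPerFormLex_le_pad_paddedPerFormLex [CharZero k] {n n' m : ℕ} [NeZero n']
    [NeZero m] (h1 : n < n') (h2 : n' < m) (χ : Weight (MatIdx m)) :
    orbitMultiplicity k (paddedPerFormLex k n m) m χ ≤
      orbitMultiplicity k (X (toLex ((0 : Fin m), (0 : Fin m))) ^ (m - n') *
        rename (blockPlace h2.le) (paddedPerFormLex k n n')) m χ := by
  haveI : Infinite k := CharZero.infinite k
  have hmem := paddedPerFormLex_mem_orbitClosure_pad_paddedPerFormLex (k := k) h1 h2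
  exact orbitMultiplicity_le_of_hwv_inf_le (NeZero.ne m) fun F hF =>
    ⟨hF.1, orbitVanishingIdeal_le_of_mem_orbitClosure hmem hF.2⟩

/-- **(C4-tower) = NOTE V26 generalised.** For `0 < n < n' < m` and `λ ⊢ m d`, `ℓ(λ) ≤ m²`:
`mult_{λ*} k[Δ(x₀₀^{m-n} per_n)] ≤ mult_{λ*} k[Δ(det_m)] + ε^{det_{n'}}(λ; d)` (Pieri sum of the `det_{n'}` deficits over the
horizontal strips `λ/μ`, `μ ⊢ n' d`, `ℓ(μ) ≤ n'²`). The cell's NOTE V26 is `(n, n', m) = (3, 4, 5)`.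
[cite: FultonHarrisGTM129, (6.8)] [cite: BurgisserEtAl2011, Prop. 6.3.2 and §6.3] -/
theorem orbitMultiplicity_paddedPerFormLex_le_detFormLex_add_capDeficitSumPieri_tower [CharZero k]
    {n n' m : ℕ} [NeZero n] [NeZero n'] [NeZero m] (h1 : n < n') (h2 : n' < m) {d : ℕ}
    (lam : Nat.Partition (m * d)) (hlam : lam.parts.card ≤ m * m) :
    orbitMultiplicity k (paddedPerFormLex k n m) m (Weight.dualOfPartition (m * m) lam).toMatIdx ≤
      orbitMultiplicity k (detFormLex k m) m (Weight.dualOfPartition (m * m) lam).toMatIdx +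
        capDeficitSumPieri (detFormLex k n') m d lam :=
  (orbitMultiplicity_paddedPerFormLex_le_pad_paddedPerFormLex h1 h2 _).trans
    (orbitMultiplicity_pad_le_detFormLex_add_capDeficitSumPieri h2
      (paddedPerFormLex_isHomogeneous k h1.le) lam hlam)

/-- **(C4-tower with certified lower bounds)** = the cell's `ε₄_cert` closing rule V26-C1: with any
`lo μ ≤ mult_{μ*} k[Δ(det_{n'})]` (`lo := 0` on unmeasured keys),
`mult_{λ*} k[Δ(x₀₀^{m-n} per_n)] ≤ mult_{λ*} k[Δ(det_m)] + Σ_{λ/μ horizontal strip, ℓ(μ) ≤ n'²} (a_{μ*} − lo μ)`.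
[cite: FultonHarrisGTM129, (6.8)] [cite: BurgisserEtAl2011, Prop. 6.3.2 and §6.3] -/
theorem orbitMultiplicity_paddedPerFormLex_le_detFormLex_add_sum_of_lowerBounds_tower [CharZero k]
    {n n' m : ℕ} [NeZero n] [NeZero n'] [NeZero m] (h1 : n < n') (h2 : n' < m) {d : ℕ}
    (lam : Nat.Partition (m * d)) (hlam : lam.parts.card ≤ m * m) (lo : Nat.Partition (n' * d) → ℕ)
    (Hlo : ∀ mu : Nat.Partition (n' * d), mu.parts.card ≤ n' * n' →
      lo mu ≤ orbitMultiplicity k (detFormLex k n') n' (Weight.dualOfPartition (n' * n') mu).toMatIdx) :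
    orbitMultiplicity k (paddedPerFormLex k n m) m (Weight.dualOfPartition (m * m) lam).toMatIdx ≤
      orbitMultiplicity k (detFormLex k m) m (Weight.dualOfPartition (m * m) lam).toMatIdx +
        ∑ mu ∈ (Finset.univ : Finset (Nat.Partition (n' * d))).filter
            (fun mu => mu.parts.card ≤ n' * n' ∧ partHorizStrip (m * m) mu lam),
          (plethysmCoeff k (MatIdx n') n' (Weight.dualOfPartition (n' * n') mu).toMatIdx - lo mu) :=
  (orbitMultiplicity_paddedPerFormLex_le_pad_paddedPerFormLex h1 h2 _).trans
    (orbitMultiplicity_pad_le_detFormLex_add_sum_of_lowerBounds_pieri h2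
      (paddedPerFormLex_isHomogeneous k h1.le) lam hlam lo Hlo)

/-- **(C4-tower, INCAPABLE criterion)** = V26's «CLOSED by V26»: if `det_{n'}` is FULL at every `μ ⊢ n' d` with
`ℓ(μ) ≤ n'²` and `λ/μ` a horizontal strip, then `x₀₀^{m-n} per_n` admits no multiplicity obstruction against
`det_m` at `λ*`. [cite: FultonHarrisGTM129, (6.8)] [cite: BurgisserEtAl2011, Prop. 6.3.2 and §6.3] -/
theorem orbitMultiplicity_paddedPerFormLex_le_detFormLex_of_forall_horizStrip_tower [CharZero k]
    {n n' m : ℕ} [NeZero n] [NeZero n'] [NeZero m] (h1 : n < n') (h2 : n' < m) {d : ℕ}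
    (lam : Nat.Partition (m * d)) (hlam : lam.parts.card ≤ m * m)
    (H : ∀ mu : Nat.Partition (n' * d), mu.parts.card ≤ n' * n' → partHorizStrip (m * m) mu lam →
      plethysmCoeff k (MatIdx n') n' (Weight.dualOfPartition (n' * n') mu).toMatIdx ≤
        orbitMultiplicity k (detFormLex k n') n' (Weight.dualOfPartition (n' * n') mu).toMatIdx) :
    orbitMultiplicity k (paddedPerFormLex k n m) m (Weight.dualOfPartition (m * m) lam).toMatIdx ≤
      orbitMultiplicity k (detFormLex k m) m (Weight.dualOfPartition (m * m) lam).toMatIdx :=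
  (orbitMultiplicity_paddedPerFormLex_le_pad_paddedPerFormLex h1 h2 _).trans
    (orbitMultiplicity_pad_le_detFormLex_of_forall_horizStrip h2
      (paddedPerFormLex_isHomogeneous k h1.le) lam hlam H)

/-- The cell's NOTE V26 verbatim: `(n, n', m) = (3, 4, 5)`. [folklore] -/
example [CharZero k] {d : ℕ} (lam : Nat.Partition (5 * d)) (hlam : lam.parts.card ≤ 5 * 5) :
    orbitMultiplicity k (paddedPerFormLex k 3 5) 5 (Weight.dualOfPartition (5 * 5) lam).toMatIdx ≤
      orbitMultiplicity k (detFormLex k 5) 5 (Weight.dualOfPartition (5 * 5) lam).toMatIdx +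
        capDeficitSumPieri (detFormLex k 4) 5 d lam :=
  orbitMultiplicity_paddedPerFormLex_le_detFormLex_add_capDeficitSumPieri_tower
    (by norm_num) (by norm_num) lam hlam

/-- The cell's «V23-bis-5» (NOTE V25: keys at `det₃`, horizontal `2d`-strips) is the tree's (C4) at
`(n, m) = (3, 5)` verbatim. [folklore] -/
example [CharZero k] {d : ℕ} (lam : Nat.Partition (5 * d)) (hlam : lam.parts.card ≤ 5 * 5) :
    orbitMultiplicity k (paddedPerFormLex k 3 5) 5 (Weight.dualOfPartition (5 * 5) lam).toMatIdx ≤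
      orbitMultiplicity k (detFormLex k 5) 5 (Weight.dualOfPartition (5 * 5) lam).toMatIdx +
        capDeficitSumPieri (detFormLex k 3) 5 d lam :=
  orbitMultiplicity_paddedPerFormLex_le_detFormLex_add_capDeficitSumPieri (by norm_num) lam hlam

/-- «V23-bis-5» INCAPABLE form (the 17 768 / 29 189 / 44 898 (3,5) window rows booked INCAPABLE at
`d = 10 / 11 / 12` cite this): `det₃` FULL at every horizontal-strip key `μ ⊢ 3d`, `ℓ(μ) ≤ 9` ⇒ no
`(x₀₀² per₃, det₅)` multiplicity obstruction at `λ*`. [folklore] -/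
example [CharZero k] {d : ℕ} (lam : Nat.Partition (5 * d)) (hlam : lam.parts.card ≤ 5 * 5)
    (H : ∀ mu : Nat.Partition (3 * d), mu.parts.card ≤ 3 * 3 → partHorizStrip (5 * 5) mu lam →
      plethysmCoeff k (MatIdx 3) 3 (Weight.dualOfPartition (3 * 3) mu).toMatIdx ≤
        orbitMultiplicity k (detFormLex k 3) 3 (Weight.dualOfPartition (3 * 3) mu).toMatIdx) :
    orbitMultiplicity k (paddedPerFormLex k 3 5) 5 (Weight.dualOfPartition (5 * 5) lam).toMatIdx ≤
      orbitMultiplicity k (detFormLex k 5) 5 (Weight.dualOfPartition (5 * 5) lam).toMatIdx :=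
  orbitMultiplicity_paddedPerFormLex_le_detFormLex_of_forall_horizStrip (by norm_num) lam hlam H

/-- NOTE V26 INCAPABLE form («CLOSED by V26»: the 33 / 103 / 6 (3,5) rows at `d = 10 / 11 / 12`):
`det₄` FULL at every horizontal-strip key `μ ⊢ 4d`, `ℓ(μ) ≤ 16` ⇒ no `(x₀₀² per₃, det₅)` obstruction at `λ*`. [folklore] -/
example [CharZero k] {d : ℕ} (lam : Nat.Partition (5 * d)) (hlam : lam.parts.card ≤ 5 * 5)
    (H : ∀ mu : Nat.Partition (4 * d), mu.parts.card ≤ 4 * 4 → partHorizStrip (5 * 5) mu lam →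
      plethysmCoeff k (MatIdx 4) 4 (Weight.dualOfPartition (4 * 4) mu).toMatIdx ≤
        orbitMultiplicity k (detFormLex k 4) 4 (Weight.dualOfPartition (4 * 4) mu).toMatIdx) :
    orbitMultiplicity k (paddedPerFormLex k 3 5) 5 (Weight.dualOfPartition (5 * 5) lam).toMatIdx ≤
      orbitMultiplicity k (detFormLex k 5) 5 (Weight.dualOfPartition (5 * 5) lam).toMatIdx :=
  orbitMultiplicity_paddedPerFormLex_le_detFormLex_of_forall_horizStrip_tower
    (by norm_num) (by norm_num) lam hlam H

end Tower

end Literature.Computability.AlgebraicComplexity
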